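import Mathlib
import Summits.Ventures.HodgeRepro2.T5AdditiveConductor

/-!
# The conductor exponent of the composite character `ψ_F ∘ Tr_{E/F}`

Tier-5 support for the (A6) step of §N5.12.6 / §N5.13.2 (route/T5-route-2.md l. 599), continuing
`T5AdditiveConductor` (p394996) and `T5TraceDualConductor` (p394400): the classical formula

  `n(ψ_E) = e · n(ψ_F) + d`   for `ψ_E := ψ_F ∘ Tr_{E/F}`,

where `e` is the ramification index and `d` the different exponent of `E_v / F_v`.  The proof
splits into

* the CONDUCTOR BOOKKEEPING (this file): for a `K`-linear map `T : L → K` (the trace),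
  «`ψ ∘ T` trivial on the ball `P_E^{-m}`» is the same as «`T` maps `P_E^{-m}` into
  `P_F^{-n(ψ)}`» (`forall_comp_iff`), PROVIDED `A` is the valuation ring of `v_F`
  (`Valuation.Integers v_F A`) and `v_E ≤ 1` on `A` — the only inputs;  hence, if `T` satisfies
  «`T(P_E^{-m}) ⊆ P_F^{-n} ⟺ m ≤ e n + d`», the conductor of `ψ ∘ T` is `e · n(ψ) + d`
  (`conductorExp_comp_eq`, `conductorExp_comp_trace_eq`);
* the TRACE–DUAL step «`Tr(P_E^{-m}) ⊆ P_F^{-n} ⟺ m ≤ e n + d`», which is the ideal-theoretic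
  statement `T5TraceDualConductor.trace_span_singleton_le_one_iff_exp` (p394400) read on balls —
  taken here as the hypothesis `hTr` and left to the owner's prose.

Uses an L-value-free non-vanishing device: NO.
-/

namespace Summit.Ventures.HodgeRepro2.T5ConductorComposite

open WithZero Summit.Ventures.HodgeRepro2.T5AdditiveConductor

variable {A K L M : Type*} [CommRing A] [Field K] [Field L] [Monoid M]
  [Algebra A K] [Algebra K L] [Algebra A L] [IsScalarTower A K L]
  (vF : Valuation K (WithZero (Multiplicative ℤ))) (vE : Valuation L (WithZero (Multiplicative ℤ)))
  (ψ : AddChar K M) (T : L →ₗ[K] K)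

/-- The balls of `L` are stable under multiplication by elements of `A` when `v_E ≤ 1` on `A`. -/
theorem val_smul_le (hcomp : ∀ a : A, vE (algebraMap A L a) ≤ 1) (a : A) {z : L} {m : ℤ}
    (hz : vE z ≤ exp m) : vE (algebraMap A K a • z) ≤ exp m := by
  rw [Algebra.smul_def, ← IsScalarTower.algebraMap_apply, Valuation.map_mul]
  calc vE (algebraMap A L a) * vE z ≤ 1 * exp m := mul_le_mul' (hcomp a) hz
    _ = exp m := one_mul _

/-- The composite character `ψ ∘ T`, evaluated. -/
theorem comp_apply (z : L) : (ψ.compAddMonoidHom T.toAddMonoidHom) z = ψ (T z) := rfl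

/-- (⇒) If `ψ ∘ T` is trivial on the ball `P_E^{-m}`, then `T` maps that ball into
`P_F^{-n(ψ)}`: otherwise some `T z` has valuation `exp j` with `j ≥ n(ψ) + 1`, and the `A`-multiples
of `z` (still in the ball) are sent onto the whole of `P_F^{-(n(ψ)+1)}`, on which `ψ` would then be
trivial — contradicting the maximality of `n(ψ)`. -/
theorem forall_val_le_conductorExp_of_forall_comp (hA : vF.Integers A)
    (hcomp : ∀ a : A, vE (algebraMap A L a) ≤ 1)
    (h₀ : ∃ k : ℤ, ∀ x : K, vF x ≤ exp k → ψ x = 1) (hψ : ∃ x : K, ψ x ≠ 1) {m : ℤ}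
    (h : ∀ z : L, vE z ≤ exp m → ψ (T z) = 1) :
    ∀ z : L, vE z ≤ exp m → vF (T z) ≤ exp (conductorExp ψ vF) := by
  intro z hz
  by_contra hlt
  rw [not_le] at hlt
  have hy0 : T z ≠ 0 := by
    intro h0
    rw [h0, Valuation.map_zero] at hlt
    exact absurd hlt (not_lt.mpr zero_le)
  obtain ⟨j, hj⟩ : ∃ j : ℤ, vF (T z) = exp j :=
    ⟨(vF (T z)).log, (exp_log ((Valuation.ne_zero_iff vF).mpr hy0)).symm⟩
  rw [hj, exp_lt_exp] at hlt
  have htriv : ∀ x : K, vF x ≤ exp (conductorExp ψ vF + 1) → ψ x = 1 := by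
    intro x hx
    have hxy : vF (x / T z) ≤ 1 := by
      rw [Valuation.map_div, hj]
      exact div_le_one_of_le₀ (hx.trans (exp_le_exp.mpr (by omega))) zero_le
    obtain ⟨a, ha⟩ := hA.exists_of_le_one hxy
    have := h (algebraMap A K a • z) (val_smul_le vE hcomp a hz)
    rwa [LinearMap.map_smul, smul_eq_mul, ha, div_mul_cancel₀ x hy0] at this
  have := (forall_le_exp_iff_le_conductorExp ψ vF h₀ hψ (conductorExp ψ vF + 1)).mp htriv
  omega

/-- (⇐) If `T` maps `P_E^{-m}` into `P_F^{-n(ψ)}`, then `ψ ∘ T` is trivial on `P_E^{-m}`. -/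
theorem forall_comp_of_forall_val_le (h₀ : ∃ k : ℤ, ∀ x : K, vF x ≤ exp k → ψ x = 1)
    (hψ : ∃ x : K, ψ x ≠ 1) {m : ℤ}
    (h : ∀ z : L, vE z ≤ exp m → vF (T z) ≤ exp (conductorExp ψ vF)) :
    ∀ z : L, vE z ≤ exp m → ψ (T z) = 1 :=
  fun z hz => forall_le_exp_conductorExp ψ vF h₀ hψ _ (h z hz)

/-- «`ψ ∘ T` trivial on `P_E^{-m}` ⟺ `T (P_E^{-m}) ⊆ P_F^{-n(ψ)}`». -/
theorem forall_comp_iff (hA : vF.Integers A) (hcomp : ∀ a : A, vE (algebraMap A L a) ≤ 1)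
    (h₀ : ∃ k : ℤ, ∀ x : K, vF x ≤ exp k → ψ x = 1) (hψ : ∃ x : K, ψ x ≠ 1) (m : ℤ) :
    (∀ z : L, vE z ≤ exp m → (ψ.compAddMonoidHom T.toAddMonoidHom) z = 1) ↔
      ∀ z : L, vE z ≤ exp m → vF (T z) ≤ exp (conductorExp ψ vF) :=
  ⟨fun h => forall_val_le_conductorExp_of_forall_comp vF vE ψ T hA hcomp h₀ hψ h,
    fun h => forall_comp_of_forall_val_le vF vE ψ T h₀ hψ h⟩

/-- THE CONDUCTOR FORMULA: if `T (P_E^{-m}) ⊆ P_F^{-n} ⟺ m ≤ e n + d` (the trace–dual relation),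
then `n(ψ ∘ T) = e · n(ψ) + d`. -/
theorem conductorExp_comp_eq (hA : vF.Integers A) (hcomp : ∀ a : A, vE (algebraMap A L a) ≤ 1)
    (h₀ : ∃ k : ℤ, ∀ x : K, vF x ≤ exp k → ψ x = 1) (hψ : ∃ x : K, ψ x ≠ 1) (e d : ℤ)
    (hTr : ∀ m n : ℤ, (∀ z : L, vE z ≤ exp m → vF (T z) ≤ exp n) ↔ m ≤ e * n + d) :
    conductorExp (ψ.compAddMonoidHom T.toAddMonoidHom) vE = e * conductorExp ψ vF + d := by
  have hiff : ∀ m : ℤ, (∀ z : L, vE z ≤ exp m → (ψ.compAddMonoidHom T.toAddMonoidHom) z = 1) ↔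
      m ≤ e * conductorExp ψ vF + d :=
    fun m => (forall_comp_iff vF vE ψ T hA hcomp h₀ hψ m).trans (hTr m _)
  have hne : ∃ z : L, (ψ.compAddMonoidHom T.toAddMonoidHom) z ≠ 1 := by
    have h := (hiff (e * conductorExp ψ vF + d + 1)).not.mpr (by omega)
    simp only [not_forall, exists_prop] at h
    obtain ⟨z, -, hz⟩ := h
    exact ⟨z, hz⟩
  apply conductorExp_eq_of
  · exact (hiff _).mpr le_rfl
  · exact (hiff _).not.mpr (by omega)
  · exact hne

/-- The same for the trace `T = Tr_{L/K}`: `n(ψ ∘ Tr) = e · n(ψ) + d`. -/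
theorem conductorExp_comp_trace_eq (hA : vF.Integers A)
    (hcomp : ∀ a : A, vE (algebraMap A L a) ≤ 1)
    (h₀ : ∃ k : ℤ, ∀ x : K, vF x ≤ exp k → ψ x = 1) (hψ : ∃ x : K, ψ x ≠ 1) (e d : ℤ)
    (hTr : ∀ m n : ℤ, (∀ z : L, vE z ≤ exp m → vF (Algebra.trace K L z) ≤ exp n) ↔ m ≤ e * n + d) :
    conductorExp (ψ.compAddMonoidHom (Algebra.trace K L).toAddMonoidHom) vE =
      e * conductorExp ψ vF + d :=
  conductorExp_comp_eq vF vE ψ (Algebra.trace K L) hA hcomp h₀ hψ e d hTr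

end Summit.Ventures.HodgeRepro2.T5ConductorComposite
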